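import Mathlib.CategoryTheory.Pi.Basic
import Mathlib.CategoryTheory.Comma.Over.Pullback
import Mathlib.CategoryTheory.Limits.Preserves.Finite
import Mathlib.CategoryTheory.Countable
import Mathlib.GroupTheory.FreeGroup.Basic
import Mathlib.Topology.Bases
import Literature.AnabelianGeometry.SemiGraphs.TemperedGroups
import Literature.AnabelianGeometry.SemiGraphs.NotationsConventions
import HarnessLib

/-!
# Semi-graphs of anabelioids, §3 (part 2): temperoids

Mochizuki, *Semi-graphs of anabelioids*, Publ. RIMS **42** (2006), §3, manuscript pp. 33–36
[cite: MochizukiSemiAnbd2006, §3 pp.33-36]: the categorical layer built on `B^temp(Π)`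
(`TemperedGroups.lean`):

* Definition 3.1 (ii) connected temperoids / temperoids (`IsConnectedTemperoid`, `IsTemperoid`,
  via the charts `ConnectedTemperoidChart`, `TemperoidChart`), (iii) morphisms of temperoids =
  functors in the opposite direction preserving finite limits and countable colimits
  (`TemperoidHom`; rigid ones `TemperoidHom.IsRigid`, rigidity of functors being the [FrdI]/[SemiAnbd]
  §0 notion `IsRigidFunctor`), (iv) Galois objects (`IsGaloisObj`);
* Remarks 3.1.3 (Galois objects of `B^temp(Π)` = the `Π/N`; torsor characterisation), 3.1.4
  (temperification `X^⊤ := (X⁰)^⊤`), 3.1.5, 3.1.6 (endomorphisms of Galois objects; the free-group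
  example) — as named facts;
* Proposition 3.2 (a theorem of the paper whose title invokes Grothendieck's anabelian philosophy):
  the category of morphisms `B^temp(Π₁) → B^temp(Π₂)` is equivalent to `ContHomCat Π₁ Π₂`
  (continuous homomorphisms and conjugating elements; `GCConnectedTemperoids`), with its "in
  particular" split as `ResIsTemperoidHom` / `TemperoidHomEqRes` / `ResIsoResIff`; Remark 3.2.1
  (`IsTemperedFundamentalGroupOf`); Corollary 3.3 (`RigidIffCentralizerTrivial`);
* Definition 3.4 (i) étale morphisms (`TemperoidHom.IsEtale`, with "abstractly equivalent" functors
  of §0 p. 7 = the §0 file's `AreAbstractlyEquivalent`), Remark 3.4.1 (`SlimIffTempSlim`).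

Deliberately NOT here: the second sentence of Definition 3.4 (i) ("An étale morphism of
temperoids is a morphism each of whose component morphisms is étale" — needs the component
morphisms of Remark 3.1.4, recorded not typed); Remark 3.4.2 (the convention of treating relatively temp-slim morphisms as
morphisms of a 1-category, pro-temperoids and universal coverings) is a working convention, not a
statement; Remarks 3.1.7–3.1.8 are bibliographic. The anabelioid halves of Remarks 3.1.4 and
3.4.1 ("an anabelioid is slim iff … iff its temperification is temp-slim") wait for the anabelioid
file of [SemiAnbd] §1–2 (cell seat abc-iut-L3-t1). The named facts for items 3.2, 3.3, 3.4 carry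
the Galois-countability (= second countability) hypothesis on every tempered group, as required by
the author's erratum [IUTchI] Rmk. 2.5.3 (ii) (E7) (pp. 52–54). No statement of the paper is
strengthened.
-/

open CategoryTheory CategoryTheory.Limits Topology

namespace Literature.AnabelianGeometry.SemiGraphs

open Literature.AlgebraicGeometry.Frobenioids (IsRigidFunctor IsSlim IsConnectedObj IsNonemptyObj
  IsAlmostTotallyEpimorphic IsOfCountablyConnectedType ConnectedPart CountableCoproductCompletion
  IsSlimGroup BCat)

universe w v₁ v₂ v₃ v₄ u u₁ u₂ u₃ u₄

/-! ### Definition 3.1 (ii): (connected) temperoids -/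

section Temperoids

variable (T : Type u₁) [Category.{v₁} T]

/-- A presentation of `T` as a connected temperoid: a tempered topological group `Π` and an
equivalence `T ≌ B^temp(Π)` (SemiAnbd §3 Def. 3.1 (ii), p. 33).
[cite: MochizukiSemiAnbd2006, Def 3.1(ii) p.33] -/
structure ConnectedTemperoidChart : Type (max u₁ v₁ (u + 1)) where
  /-- the tempered group -/
  G : Type u
  /-- its group structure -/
  [group : Group G]
  /-- its topology -/
  [topologicalSpace : TopologicalSpace G]
  /-- it is a topological group -/
  [isTopologicalGroup : IsTopologicalGroup G]
  /-- it is tempered -/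
  isTempered : IsTempered G
  /-- `T ≌ B^temp(Π)` -/
  equiv : T ≌ BTemp G

attribute [instance] ConnectedTemperoidChart.group ConnectedTemperoidChart.topologicalSpace
  ConnectedTemperoidChart.isTopologicalGroup

/-- **Definition 3.1 (ii)** (SemiAnbd §3 p. 33): "Any category equivalent to a category of the form
`B^temp(Π)` for some tempered topological group `Π` will be referred to as a *connected temperoid*."
[cite: MochizukiSemiAnbd2006, Def 3.1(ii) p.33] -/
def IsConnectedTemperoid : Prop := Nonempty (ConnectedTemperoidChart.{v₁, u, u₁} T)

/-- A presentation of `T` as a temperoid: a countable family of tempered groups `Πᵢ` and an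
equivalence of `T` with the product category `∏ᵢ B^temp(Πᵢ)` (SemiAnbd §3 Def. 3.1 (ii), p. 33;
since every connected temperoid is equivalent to some `B^temp(Πᵢ)`, charts of this shape exist
for every category equivalent to a countable product of connected temperoids).
[cite: MochizukiSemiAnbd2006, Def 3.1(ii) p.33] -/
structure TemperoidChart : Type (max u₁ v₁ (u + 1)) where
  /-- the [countable, possibly empty] index set -/
  ι : Type
  /-- it is countable -/
  countable : Countable ι
  /-- the tempered groups of the connected components -/
  G : ι → Type u
  /-- their group structures -/
  [group : ∀ i, Group (G i)]
  /-- their topologies -/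
  [topologicalSpace : ∀ i, TopologicalSpace (G i)]
  /-- they are topological groups -/
  [isTopologicalGroup : ∀ i, IsTopologicalGroup (G i)]
  /-- they are tempered -/
  isTempered : ∀ i, IsTempered (G i)
  /-- `T ≌ ∏ᵢ B^temp(Πᵢ)` [a product of categories] -/
  equiv : T ≌ (∀ i, BTemp (G i))

attribute [instance] TemperoidChart.group TemperoidChart.topologicalSpace
  TemperoidChart.isTopologicalGroup

/-- **Definition 3.1 (ii)** (SemiAnbd §3 p. 33): "Any category equivalent to a product [in the sense
of a product of categories] of a countable [hence possibly empty!] collection of connected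
temperoids will be referred to as a *temperoid*." [cite: MochizukiSemiAnbd2006, Def 3.1(ii) p.33] -/
def IsTemperoid : Prop := Nonempty (TemperoidChart.{v₁, u, u₁} T)

/-- The components of a temperoid chart are connected temperoids. [cite: MochizukiSemiAnbd2006, Def 3.1(ii) p.33] -/
theorem TemperoidChart.isConnectedTemperoid_component (c : TemperoidChart.{v₁, u, u₁} T) (i : c.ι) :
    IsConnectedTemperoid.{u, u, u + 1} (BTemp (c.G i)) :=
  ⟨{ G := c.G i, isTempered := c.isTempered i, equiv := CategoryTheory.Equivalence.refl }⟩

end Temperoids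

/-! ### Definition 3.1 (iii): morphisms of temperoids -/

section Morphisms

variable (T₁ : Type u₁) [Category.{v₁} T₁] (T₂ : Type u₂) [Category.{v₂} T₂]

/-- **Definition 3.1 (iii)** (SemiAnbd §3 p. 33): "a *morphism* `φ : T₁ → T₂` is defined to be a
functor `φ^* : T₂ → T₁` that preserves finite limits and countable colimits."
[cite: MochizukiSemiAnbd2006, Def 3.1(iii) p.33] -/
structure TemperoidHom : Type (max u₁ u₂ v₁ v₂) where
  /-- the pull-back functor `φ^* : T₂ ⥤ T₁` -/
  pullback : T₂ ⥤ T₁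
  /-- `φ^*` preserves finite limits -/
  preservesFiniteLimits : PreservesFiniteLimits pullback
  /-- `φ^*` preserves countable colimits -/
  preservesCountableColimits : ∀ (J : Type) [SmallCategory J] [CountableCategory J],
    PreservesColimitsOfShape J pullback

variable {T₁ T₂}

/-- **Definition 3.1 (iii)** (SemiAnbd §3 p. 33): "A morphism `φ` will be called *rigid* if the
functor `φ^*` is rigid [cf. §0]" (§0 p. 6: a functor is rigid if it has no nontrivial
automorphisms — the tree's `IsRigidFunctor`). [cite: MochizukiSemiAnbd2006, Def 3.1(iii) p.33] -/
def TemperoidHom.IsRigid (φ : TemperoidHom T₁ T₂) : Prop := IsRigidFunctor φ.pullback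

end Morphisms

/-! ### Definition 3.1 (iv): Galois objects; Remarks 3.1.3–3.1.6 -/

section Galois

variable {C : Type u₁} [Category.{v₁} C]

/-- **Definition 3.1 (iv)** (SemiAnbd §3 p. 33): "A connected object `T` of a temperoid `T` will
be called *Galois* if, for any two arrows `ψ₁, ψ₂ : S → T` of `T`, where `S` is connected, there
exists a [unique] automorphism `α ∈ Aut_T(T)` of `T` such that `ψ₁ = α ∘ ψ₂`." (Stated in any
category, with "connected" the §0 notion; the bracketed uniqueness is the paper's remark, not part
of the condition.) [cite: MochizukiSemiAnbd2006, Def 3.1(iv) p.33] -/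
def IsGaloisObj (T : C) : Prop :=
  IsConnectedObj T ∧ ∀ (S : C), IsConnectedObj S → ∀ ψ₁ ψ₂ : S ⟶ T, ∃ α : Aut T, ψ₁ = ψ₂ ≫ α.hom

variable (G : Type u) [Group G] [TopologicalSpace G] [IsTopologicalGroup G]

/-- The object `Π/H` of `Action (Type u) Π` for a subgroup `H`, packaged as an object of
`B^temp(Π)` when `H` is open and `Π` tempered (Remark 3.1.2). [cite: MochizukiSemiAnbd2006, Rmk 3.1.2 p.33] -/
def BTemp.quotientObj (hG : IsTempered G) (H : Subgroup G) (hH : IsOpen (H : Set G)) : BTemp G :=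
  ⟨Action.ofMulAction G (G ⧸ H), (temperedAction_quotient_iff hG H).mpr hH⟩

/-- **Remark 3.1.3**, first sentence (SemiAnbd §3 p. 34), named fact: "Suppose that `Π` is
tempered. Then an object of `B^temp(Π)` is Galois if and only if it is isomorphic to the object
determined by a `Π`-set of the form `Π/N`, where `N ⊆ Π` is an open normal subgroup."
[cite: MochizukiSemiAnbd2006, Rmk 3.1.3 p.34] -/
def GaloisObjIffQuotientOpenNormal : Prop :=
  ∀ hG : IsTempered G, ∀ X : BTemp G,
    IsGaloisObj X ↔ ∃ N : OpenNormalSubgroup G,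
      Nonempty (X ≅ BTemp.quotientObj G hG N.toSubgroup N.isOpen')

/-- **Remark 3.1.3**, second sentence (SemiAnbd §3 p. 34), named fact: "a connected object `T` of
`T := B^temp(Π)` is Galois if and only if the product `T × T` is isomorphic to the coproduct of
copies of `T` indexed by the elements of the [countable!] set `Aut_T(T)`, where the restriction to
the copy labeled by `σ ∈ Aut_T(T)` of the projection to the first (respectively, second) factor of
`T × T` is given by the identity (respectively, `σ`)" — i.e. the cofan `(𝟙, σ)_σ : ∐_{Aut T} T → T × T`
is a coproduct, stated with a binary-product cone and a cofan so that no choice of (co)limit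
objects is needed. [cite: MochizukiSemiAnbd2006, Rmk 3.1.3 p.34] -/
def GaloisObjIffTorsor : Prop :=
  IsTempered G → ∀ T : BTemp G, IsConnectedObj T →
    (IsGaloisObj T ↔ ∀ (P : BinaryFan T T) (hP : IsLimit P),
      Nonempty (IsColimit (Cofan.mk P.pt fun σ : Aut T =>
        (hP.lift (BinaryFan.mk (𝟙 T) σ.hom) : T ⟶ P.pt))))

/-- **Remark 3.1.6** (SemiAnbd §3 p. 34), named fact: "it is immediate from the definitions that
every endomorphism of a Galois connected object of a temperoid is an automorphism" (for
`B^temp(Π)`). [cite: MochizukiSemiAnbd2006, Rmk 3.1.6 p.34] -/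
def EndOfGaloisIsIso : Prop :=
  IsTempered G → ∀ T : BTemp G, IsGaloisObj T → ∀ f : T ⟶ T, IsIso f

/-- **Remark 3.1.6** (SemiAnbd §3 p. 34), the example, named fact: "if `Π` is a [discrete] free
group on generators `e₁, e₂`, and `H ⊆ Π` is the subgroup generated by elements of the form
`e₂ⁿ · e₁ · e₂⁻ⁿ`, where `n` ranges over the positive integers, then conjugation by `e₂` determines
an endomorphism `H → H` [i.e., an endomorphism of the object determined by the `Π`-set `Π/H` of
`B^temp(Π)`] which is not an automorphism": here as the group-theoretic core — `e₂ H e₂⁻¹ ⊆ H`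
(conjugation by `e₂` maps the generator `e₂ⁿ e₁ e₂⁻ⁿ` to `e₂ⁿ⁺¹ e₁ e₂⁻⁽ⁿ⁺¹⁾`, so
`gH ↦ g e₂⁻¹ H` is a well-defined `Π`-endomorphism of `Π/H`, surjective) but `e₂⁻¹ H e₂ ⊄ H`
(`e₂⁻¹ (e₂ e₁ e₂⁻¹) e₂ = e₁ ∉ H`, so that endomorphism is not injective). [Conjugation directions
as corrected by referee abc-iut-ref-a, PASS-A3.] [cite: MochizukiSemiAnbd2006, Rmk 3.1.6 p.34] -/
def FreeGroupEndoNotAuto : Prop :=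
  let e₁ : FreeGroup (Fin 2) := FreeGroup.of 0
  let e₂ : FreeGroup (Fin 2) := FreeGroup.of 1
  let H : Subgroup (FreeGroup (Fin 2)) :=
    Subgroup.closure (Set.range fun n : ℕ => e₂ ^ (n + 1) * e₁ * (e₂ ^ (n + 1))⁻¹)
  (∀ h ∈ H, e₂ * h * e₂⁻¹ ∈ H) ∧ ¬ (∀ h ∈ H, e₂⁻¹ * h * e₂ ∈ H)

end Galois

/-! ### Remark 3.1.4 (temperification) and Remark 3.1.5 -/

section Temperification

variable (X : Type u₁) [Category.{v₁} X]

/-- **Remark 3.1.4** (SemiAnbd §3 p. 34): the *temperification* `X^⊤ := (X⁰)^⊤` of a category —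
countable formal coproducts of connected objects (§0: `C⁰` the connected part, `C^⊤` the countable
coproduct completion; both from the [FrdI]/[SemiAnbd] §0 dictionary in the tree).
[cite: MochizukiSemiAnbd2006, Rmk 3.1.4 p.34] -/
abbrev temperification := CountableCoproductCompletion.{w} (ConnectedPart X)

/-- **Remark 3.1.4** (SemiAnbd §3 p. 34), named fact: "if `X` is an anabelioid (respectively,
connected anabelioid), then `X^⊤ := (X⁰)^⊤` is a temperoid (respectively, connected temperoid)" —
stated for the connected anabelioids `B(Π)`, `Π` profinite (§0 p. 6), the general anabelioid case
being the countable product of these. [cite: MochizukiSemiAnbd2006, Rmk 3.1.4 p.34] -/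
def TemperificationIsConnectedTemperoid : Prop :=
  ∀ (G : Type u) [Group G] [TopologicalSpace G] [IsTopologicalGroup G] [CompactSpace G]
    [TotallyDisconnectedSpace G],
    IsConnectedTemperoid.{u, u, u + 1} (temperification.{u} (BCat G))

/-- **Remark 3.1.5** (SemiAnbd §3 p. 34), named fact: "It is immediate from the definitions that
every temperoid is an almost totally epimorphic category of countably connected type [cf. §0]."
[cite: MochizukiSemiAnbd2006, Rmk 3.1.5 p.34] -/
def TemperoidAlmostTotallyEpimorphic : Prop :=
  ∀ (T : Type u₁) [Category.{v₁} T], IsTemperoid.{v₁, u, u₁} T →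
    IsAlmostTotallyEpimorphic T ∧ IsOfCountablyConnectedType T

end Temperification

/-! ### Proposition 3.2, Remark 3.2.1, Corollary 3.3 -/

section GC

variable (G₁ : Type u) [Group G₁] [TopologicalSpace G₁] (G₂ : Type u) [Group G₂] [TopologicalSpace G₂]

/-- The category appearing in **Proposition 3.2** (SemiAnbd §3 p. 35): "the category whose objects
are continuous group homomorphisms `φ : Π₁ → Π₂` and whose morphisms `φ → ψ` are elements
`g ∈ Π₂` such that `γ_g ∘ φ = ψ`, where we write `γ_g` for the automorphism of `Π₂` given by
conjugating by `g`" (composition = multiplication in `Π₂`).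
[cite: MochizukiSemiAnbd2006, Prop 3.2 p.35] -/
structure ContHomCat : Type u where
  /-- a continuous homomorphism `Π₁ → Π₂` -/
  hom : G₁ →ₜ* G₂

namespace ContHomCat

variable {G₁ G₂}

/-- Morphisms `φ → ψ` of `ContHomCat`: elements `g ∈ Π₂` with `γ_g ∘ φ = ψ`.
[cite: MochizukiSemiAnbd2006, Prop 3.2 p.35] -/
@[ext] structure Hom (φ ψ : ContHomCat G₁ G₂) : Type u where
  /-- the conjugating element -/
  elt : G₂
  /-- `g φ(x) g⁻¹ = ψ(x)` for all `x` -/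
  conj_eq : ∀ x : G₁, elt * φ.hom x * elt⁻¹ = ψ.hom x

/-- `ContHomCat Π₁ Π₂` is a category: identities are `1 ∈ Π₂`, composition is multiplication
(`h ∘ g ↦ h * g`). [cite: MochizukiSemiAnbd2006, Prop 3.2 p.35] -/
instance : Category (ContHomCat G₁ G₂) where
  Hom := Hom
  id φ := ⟨1, fun x => by simp⟩
  comp f g := ⟨g.elt * f.elt, fun x => by
    rw [← g.conj_eq x, ← f.conj_eq x]
    simp only [mul_inv_rev, mul_assoc]⟩
  id_comp f := by ext; simp
  comp_id f := by ext; simp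
  assoc f g h := by ext; simp [mul_assoc]

end ContHomCat

/-- The category of morphisms of temperoids `T₁ → T₂` (Definition 3.1 (iii)): the full subcategory
of the functor category `T₂ ⥤ T₁` on the functors preserving finite limits and countable
colimits. [cite: MochizukiSemiAnbd2006, Def 3.1(iii) p.33] -/
abbrev TemperoidHomCat (T₁ : Type u₁) [Category.{v₁} T₁] (T₂ : Type u₂) [Category.{v₂} T₂] :=
  ObjectProperty.FullSubcategory fun F : T₂ ⥤ T₁ =>
    PreservesFiniteLimits F ∧ ∀ (J : Type) [SmallCategory J] [CountableCategory J],
      PreservesColimitsOfShape J F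

/-- **Proposition 3.2** (its printed title invokes Grothendieck's anabelian philosophy "for
Connected Temperoids"; it is a theorem of the paper) (SemiAnbd §3
p. 35), named fact: "For `i = 1, 2`, let `Πᵢ` be a tempered [topological] group; write
`Tᵢ := B^temp(Πᵢ)`. Then the category of morphisms `T₁ → T₂` is equivalent to the category whose
objects are continuous group homomorphisms `φ : Π₁ → Π₂` and whose morphisms `φ → ψ` are elements
`g ∈ Π₂` such that `γ_g ∘ φ = ψ`". [As amended in [IUTchI] Rmk. 2.5.3 (ii) (E7): the tempered groups are assumed Galois-countable, i.e. second countable.] [cite: MochizukiSemiAnbd2006, Prop 3.2 p.35] -/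
def GCConnectedTemperoids : Prop :=
  ∀ [IsTopologicalGroup G₁] [IsTopologicalGroup G₂] [SecondCountableTopology G₁]
    [SecondCountableTopology G₂], IsTempered G₁ → IsTempered G₂ →
    Nonempty (TemperoidHomCat (BTemp G₁) (BTemp G₂) ≌ ContHomCat G₁ G₂)

/-- Named fact underlying Remark 3.1.2 (p. 34, first lines) / Proposition 3.2: for a continuous
homomorphism `φ : Π₁ → Π₂` of tempered groups the pull-back functor `B^temp(φ) = BTemp.res φ`
"determines a morphism of connected temperoids", i.e. preserves finite limits and countable
colimits. [As amended in [IUTchI] Rmk. 2.5.3 (ii) (E7): the tempered groups are assumed Galois-countable, i.e. second countable.] [cite: MochizukiSemiAnbd2006, Rmk 3.1.2 p.34] -/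
def ResIsTemperoidHom : Prop :=
  ∀ [IsTopologicalGroup G₁] [IsTopologicalGroup G₂] [SecondCountableTopology G₁]
    [SecondCountableTopology G₂], IsTempered G₁ → IsTempered G₂ →
    ∀ φ : G₁ →ₜ* G₂, PreservesFiniteLimits (BTemp.res φ) ∧
      ∀ (J : Type) [SmallCategory J] [CountableCategory J], PreservesColimitsOfShape J (BTemp.res φ)

/-- **Proposition 3.2**, "in particular" (SemiAnbd §3 p. 35), surjectivity half, named fact: every
morphism of temperoids `B^temp(Π₁) → B^temp(Π₂)` is isomorphic to `B^temp(φ)` for some continuous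
homomorphism `φ : Π₁ → Π₂` ("there is a natural bijective correspondence between the set of
isomorphism classes of morphisms `T₁ → T₂` and the set of [continuous] outer homomorphisms
`Π₁ → Π₂`"). [As amended in [IUTchI] Rmk. 2.5.3 (ii) (E7): the tempered groups are assumed Galois-countable, i.e. second countable.] [cite: MochizukiSemiAnbd2006, Prop 3.2 p.35] -/
def TemperoidHomEqRes : Prop :=
  ∀ [IsTopologicalGroup G₁] [IsTopologicalGroup G₂] [SecondCountableTopology G₁]
    [SecondCountableTopology G₂], IsTempered G₁ → IsTempered G₂ →
    ∀ Φ : TemperoidHom (BTemp G₁) (BTemp G₂), ∃ φ : G₁ →ₜ* G₂, Nonempty (Φ.pullback ≅ BTemp.res φ)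

/-- **Proposition 3.2**, "in particular" (SemiAnbd §3 p. 35), injectivity half, named fact:
`B^temp(φ) ≅ B^temp(ψ)` if and only if `φ` and `ψ` define the same outer homomorphism, i.e.
`ψ = γ_g ∘ φ` for some `g ∈ Π₂`. [As amended in [IUTchI] Rmk. 2.5.3 (ii) (E7): the tempered groups are assumed Galois-countable, i.e. second countable.] [cite: MochizukiSemiAnbd2006, Prop 3.2 p.35] -/
def ResIsoResIff : Prop :=
  ∀ [IsTopologicalGroup G₁] [IsTopologicalGroup G₂] [SecondCountableTopology G₁]
    [SecondCountableTopology G₂], IsTempered G₁ → IsTempered G₂ →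
    ∀ φ ψ : G₁ →ₜ* G₂,
      Nonempty (BTemp.res φ ≅ BTemp.res ψ) ↔ ∃ g : G₂, ∀ x : G₁, g * φ x * g⁻¹ = ψ x

variable {G₁ G₂} in
/-- **Remark 3.2.1** (SemiAnbd §3 p. 35): "Proposition 3.2 implies that, if `X` is a connected
temperoid, then it makes sense to write `π₁^temp(X)` … [which is well-defined, up to inner
automorphism] as the *tempered fundamental group* of `X`": the relation "`Π` is a tempered
fundamental group of `X`", i.e. `Π` is tempered and `X ≌ B^temp(Π)`.
[cite: MochizukiSemiAnbd2006, Rmk 3.2.1 p.35] -/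
def IsTemperedFundamentalGroupOf (X : Type u₁) [Category.{v₁} X] (G : Type u) [Group G]
    [TopologicalSpace G] : Prop :=
  IsTempered G ∧ Nonempty (X ≌ BTemp G)

/-- **Corollary 3.3 (Rigid Morphisms of Connected Temperoids)** (SemiAnbd §3 p. 35), named fact:
"Let `φ : Π₁ → Π₂` be a continuous homomorphism that gives rise to a morphism of temperoids
`B^temp(φ) : T₁ → T₂`. Then `B^temp(φ)` is rigid if and only if the centralizer `Z_{Π₂}(Im(φ))` is
trivial." [As amended in [IUTchI] Rmk. 2.5.3 (ii) (E7): the tempered groups are assumed Galois-countable, i.e. second countable.] [cite: MochizukiSemiAnbd2006, Cor 3.3 p.35] -/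
def RigidIffCentralizerTrivial : Prop :=
  ∀ [IsTopologicalGroup G₁] [IsTopologicalGroup G₂] [SecondCountableTopology G₁]
    [SecondCountableTopology G₂], IsTempered G₁ → IsTempered G₂ →
    ∀ φ : G₁ →ₜ* G₂,
      IsRigidFunctor (BTemp.res φ) ↔ Subgroup.centralizer (Set.range φ : Set G₂) = ⊥

end GC

/-! ### Definition 3.4 (i): étale morphisms; Remark 3.4.1 -/

section Etale

variable {T₁ : Type u₁} [Category.{v₁} T₁] {T₂ : Type u₂} [Category.{v₂} T₂]

/-- **Definition 3.4 (i)** (SemiAnbd §3 p. 36): "An *étale* morphism of connected temperoids is a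
morphism that is abstractly equivalent to a morphism of the form `T_T → T`" — where (p. 35) for an
object `T` of a connected temperoid `T`, "the category `T_T` forms a temperoid … forming the product
with `T` yields a functor `T → T_T` which determines a morphism of temperoids `T_T → T`". So
`φ : T₁ → T₂` is étale iff its pull-back functor `φ^* : T₂ ⥤ T₁` is abstractly equivalent to
`(-) × A : T₂ ⥤ (T₂)_A` (Mathlib `Over.star A`) for some object `A` of `T₂`.
[cite: MochizukiSemiAnbd2006, Def 3.4(i) p.36] -/
def TemperoidHom.IsEtale [HasBinaryProducts T₂] (φ : TemperoidHom T₁ T₂) : Prop :=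
  ∃ A : T₂, AreAbstractlyEquivalent φ.pullback (Over.star A)

/-- **Definition 3.4 (ii)**, last sentence (SemiAnbd §3 p. 36): "A temperoid will be called
*temp-slim* if and only if each of its connected components is equivalent to the `B^temp(−)` of
some temp-slim tempered group" — via a chart all of whose groups are temp-slim (`IsSlimGroup`).
[cite: MochizukiSemiAnbd2006, Def 3.4(ii) p.36] -/
def IsTempSlimTemperoid (T : Type u₁) [Category.{v₁} T] : Prop :=
  ∃ c : TemperoidChart.{v₁, u, u₁} T, ∀ i, IsSlimGroup (c.G i)

/-- **Remark 3.4.1** (SemiAnbd §3 p. 36), named fact (the temperoid sentence, for connected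
temperoids `B^temp(Π)`): "a temperoid is slim as a category [cf. §0] if and only if it is temp-slim
as a temperoid". [As amended in [IUTchI] Rmk. 2.5.3 (ii) (E7): the tempered groups are assumed Galois-countable, i.e. second countable.] [cite: MochizukiSemiAnbd2006, Rmk 3.4.1 p.36] -/
def SlimIffTempSlim : Prop :=
  ∀ (G : Type u) [Group G] [TopologicalSpace G] [IsTopologicalGroup G] [SecondCountableTopology G],
    IsTempered G → (IsSlim (BTemp G) ↔ IsSlimGroup G)

end Etale

end Literature.AnabelianGeometry.SemiGraphs
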